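/-
Copyright (c) 2026 the pub-hodgecm-mathlib formalisation cell (harness21).  Prover seat hodgecm-mathlib-K2E1-p09 (g4), Track B ∕ K2-LIT,
h413 = `stmt-HodgeConjecture-24833`, line `K2_E1_TraceFormulaBeta`, campaign RES-RANK-ONE, page «EIS-RANK-ONE», SPEC «EIS-R6» v2 §2′: «EIS-R6f-ii-prep» `K2E1IntertwiningAdjoint`,
file (I) = the generic covering-weight engine; DEAL K2E1-plan (g3) 2026-09-04T05:05:55Z, REPORT-FIRST 05:22Z.
-/
import Literature.MeasureTheory.Group.CoveringWeightsBochner      -- ★ `coveringSum`, `IsCoveringWeight`, `wt`, Bochner weight independence `integral_wt_smul_eq_of_coveringSum_eq_one`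
import Mathlib.MeasureTheory.Group.Integral                       -- Mathlib `integral_mul_left_eq_self`
import Mathlib.MeasureTheory.Integral.Prod                        -- Mathlib Fubini `integral_integral_swap`
import HarnessLib

/-!
# h413 ∕ Track B «K2-LIT», page EIS-RANK-ONE — `K2E1IntertwiningAdjointEngine`: the covering-weight engine behind the adjointness `⟨M_w h, f'⟩_B = ⟨h, M_{w⁻¹} f'⟩_B` of the
# intertwining integral (generic measurable group `G`, subgroup `U` with a measure `μ_U`, countable subgroup `Γ_T`, left-invariant `ν` on `G`)

Cell `pub/hodgecm-mathlib`, crux H413 = `stmt-HodgeConjecture-24833`, route `HCCMUnconditional`; dealer K2E1-plan (g3).  THEOREMS ONLY (no `def`, no `instance`, no `notation`, no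
named-fact hypothesis, no `sorry`); lane `--kind proof --supports stmt-HodgeConjecture-24833 --as helper` (count-neutral).  Mathlib + ★ `Literature.MeasureTheory.Group.CoveringWeights(Bochner)`
only; the Mok `U(J_N)` instances live in file (II) `K2E1IntertwiningAdjoint`.

* §1 (E1) **THE FIBRE WEIGHT**: `∫_G wt β(g) • (∫_U Φ(u g) dμ_U) dν = ∫_G wt B_β(g) • Φ(g) dν` with `B_β(g) := ∫⁻_U β(u⁻¹ g) dμ_U` — Fubini on `G × U` and the left-invariance
  `g ↦ u⁻¹ g` of `ν`; hypothesis-first absolute convergence `∫⁻_G β · ∫⁻_U ‖Φ(u ·)‖ < ∞` (with the two integrability lemmas it needs, exported).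
* §2 (E3) **TWISTING A `Γ_T`-WEIGHT BY A NORMALISER**: `coveringSum Γ_T (B ∘ (w ·)) g = coveringSum Γ_T B (w g)` when `w Γ_T w⁻¹ = Γ_T`.
* §3 (E4) **WEIGHT INDEPENDENCE WITH A TWIST**: for a `Γ_T`-invariant `Φ` and a weight `B` of constant covering sum `V ∈ (0, ∞)`, `∫ wt B • Φ dν = ∫ wt B • Φ(w⁻¹ ·) dν` (★ Bochner
  `integral_wt_smul_eq_of_coveringSum_eq_one` for `V⁻¹B`, `V⁻¹B∘(w·)`, then `g ↦ w g`).
* §4 (E1c) `∫⁻ ‖Φ‖ B_β = ∫⁻ β ∫⁻_U ‖Φ(u·)‖` (the `L¹` hypothesis of (E4) is the one of (E1)); `B_β` measurable.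
* §5 (E2) **THE COVERING SUM OF THE FIBRE WEIGHT**: for a `Γ_B`-covering weight `β` with `Γ_B = Γ_T ⋉ Γ_N` (bijectively), `Γ_N ≤ U` with a fundamental domain `𝓕`, `μ_U` inversion- and
  `Γ_T`-conjugation-invariant: `Σ_{t∈Γ_T} B_β(t g) = μ_U(𝓕)`.
* §6 (E5) **THE ADJOINTNESS, generic**: `∫ wt β • (M_w h · conj f') dν = ∫ wt β • (h · conj M_{w⁻¹} f') dν`.

HONEST LABEL.  Count-neutral helper; proves no printed statement; HC_CM is proved only modulo the 7 printed citations (2 remaining named inputs: hLiu418 =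
`stmt-HodgeConjecture-24832`, h413 = `stmt-HodgeConjecture-24833`) until rung 0 closes.

## References
* [MoeglinWaldspurger1995] C. Mœglin, J.-L. Waldspurger, *Spectral decomposition and Eisenstein series* (1995), II.1.6–II.1.8 (adjoint of `M(w, π)`), IV.2.
* [Garrett2018] P. Garrett, *Modern Analysis of Automorphic Forms by Example* 1 (2018), §1.10–§1.11 (Maass–Selberg: «the two unwindings»).
-/

set_option autoImplicit false
set_option linter.dupNamespace false  -- the mandated namespace repeats the summit's segment (`HodgeConjecture.HodgeConjecture`)

noncomputable section
open MeasureTheory Measure Set Filter Function Literature.MeasureTheory.Group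
open scoped ENNReal NNReal Pointwise

namespace Summit.HodgeConjecture.HodgeConjecture.Cruxes.H413.K2E1IntertwiningAdjointEngine

/-! ## §0 Plumbing: a subgroup acting on `G` by left multiplication -/

section Plumbing

variable {G : Type*} [Group G] [MeasurableSpace G] [MeasurableMul G]

/-- Left multiplication by elements of a subgroup is measurable (`MeasurableConstSMul ↥Γ G`). [folklore] -/
theorem measurableConstSMul_subgroup (Γ : Subgroup G) : MeasurableConstSMul Γ G :=
  ⟨fun c => measurable_const_mul (c : G)⟩

/-- A left-invariant measure is invariant under a subgroup acting by left multiplication. [folklore] -/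
theorem smulInvariantMeasure_subgroup (Γ : Subgroup G) (ν : Measure G) [ν.IsMulLeftInvariant] : SMulInvariantMeasure Γ G ν :=
  ⟨fun c _s _hs => measure_preimage_mul ν (c : G) _⟩

end Plumbing

/-! ## §1 (E1) The fibre weight: `∫ wt β • (∫_U Φ(u ·)) dν = ∫ wt B_β • Φ dν`, `B_β(g) = ∫⁻_U β(u⁻¹ g)` -/

section Fibre

variable {G : Type*} [Group G] [MeasurableSpace G] [MeasurableMul₂ G] [MeasurableInv G] (ν : Measure G) [SFinite ν] [ν.IsMulLeftInvariant]
  (U : Subgroup G) (μU : Measure U) [SFinite μU]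

/-- `‖(β g).toReal • z‖ₑ = β g · ‖z‖ₑ` for finite `β g`. [folklore] -/
theorem enorm_toReal_smul {b : ℝ≥0∞} (hb : b ≠ ∞) (z : ℂ) : ‖b.toReal • z‖ₑ = b * ‖z‖ₑ := by
  rw [enorm_smul, Real.enorm_of_nonneg ENNReal.toReal_nonneg, ENNReal.ofReal_toReal hb]

omit [MeasurableInv G] [SFinite ν] [ν.IsMulLeftInvariant] in
/-- **INTEGRABILITY OF THE KERNEL `(g, u) ↦ wt β(g) • Φ(u g)`** on `G × U` from `∫⁻_G β(g) ∫⁻_U ‖Φ(u g)‖ dμ_U dν < ∞` (Tonelli). [folklore] -/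
theorem integrable_wt_smul_translate {β : G → ℝ≥0∞} (hβ : Measurable β) (hβfin : ∀ g, β g ≠ ∞) {Φ : G → ℂ} (hΦ : Measurable Φ)
    (hint : ∫⁻ g, β g * ∫⁻ u, ‖Φ ((u : G) * g)‖ₑ ∂μU ∂ν < ∞) :
    Integrable (fun p : G × U => (β p.1).toReal • Φ ((p.2 : G) * p.1)) (ν.prod μU) := by
  have hmeas : Measurable fun p : G × U => (β p.1).toReal • Φ ((p.2 : G) * p.1) :=
    (ENNReal.measurable_toReal.comp (hβ.comp measurable_fst)).smul (hΦ.comp ((measurable_subtype_coe.comp measurable_snd).mul measurable_fst))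
  refine ⟨hmeas.aestronglyMeasurable, ?_⟩
  have hk : Measurable fun p : G × U => β p.1 * ‖Φ ((p.2 : G) * p.1)‖ₑ :=
    (hβ.comp measurable_fst).mul (hΦ.comp ((measurable_subtype_coe.comp measurable_snd).mul measurable_fst)).enorm
  rw [HasFiniteIntegral]
  calc ∫⁻ p, ‖(β p.1).toReal • Φ ((p.2 : G) * p.1)‖ₑ ∂(ν.prod μU)
      = ∫⁻ p, β p.1 * ‖Φ ((p.2 : G) * p.1)‖ₑ ∂(ν.prod μU) := lintegral_congr fun p => enorm_toReal_smul (hβfin _) _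
    _ = ∫⁻ g, ∫⁻ u, β g * ‖Φ ((u : G) * g)‖ₑ ∂μU ∂ν := lintegral_prod _ hk.aemeasurable
    _ = ∫⁻ g, β g * ∫⁻ u, ‖Φ ((u : G) * g)‖ₑ ∂μU ∂ν :=
        lintegral_congr fun g => lintegral_const_mul _ (hΦ.comp (measurable_subtype_coe.mul_const g)).enorm
    _ < ∞ := hint

/-- **INTEGRABILITY OF THE SHEARED KERNEL `(g, u) ↦ wt β(u⁻¹ g) • Φ(g)`** from the same hypothesis (Tonelli, swap, `g ↦ u g` by left-invariance, swap back). [folklore] -/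
theorem integrable_wt_shear_smul {β : G → ℝ≥0∞} (hβ : Measurable β) (hβfin : ∀ g, β g ≠ ∞) {Φ : G → ℂ} (hΦ : Measurable Φ)
    (hint : ∫⁻ g, β g * ∫⁻ u, ‖Φ ((u : G) * g)‖ₑ ∂μU ∂ν < ∞) :
    Integrable (fun p : G × U => (β (((p.2 : G))⁻¹ * p.1)).toReal • Φ p.1) (ν.prod μU) := by
  have hsh : Measurable fun p : G × U => ((p.2 : G))⁻¹ * p.1 := ((measurable_subtype_coe.comp measurable_snd).inv).mul measurable_fst
  have hmeas : Measurable fun p : G × U => (β (((p.2 : G))⁻¹ * p.1)).toReal • Φ p.1 :=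
    (ENNReal.measurable_toReal.comp (hβ.comp hsh)).smul (hΦ.comp measurable_fst)
  refine ⟨hmeas.aestronglyMeasurable, ?_⟩
  have hk : Measurable fun p : G × U => β (((p.2 : G))⁻¹ * p.1) * ‖Φ p.1‖ₑ := (hβ.comp hsh).mul (hΦ.comp measurable_fst).enorm
  have hk' : Measurable fun p : G × U => β p.1 * ‖Φ ((p.2 : G) * p.1)‖ₑ :=
    (hβ.comp measurable_fst).mul (hΦ.comp ((measurable_subtype_coe.comp measurable_snd).mul measurable_fst)).enorm
  rw [HasFiniteIntegral]
  calc ∫⁻ p, ‖(β (((p.2 : G))⁻¹ * p.1)).toReal • Φ p.1‖ₑ ∂(ν.prod μU)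
      = ∫⁻ p, β (((p.2 : G))⁻¹ * p.1) * ‖Φ p.1‖ₑ ∂(ν.prod μU) := lintegral_congr fun p => enorm_toReal_smul (hβfin _) _
    _ = ∫⁻ g, ∫⁻ u, β (((u : G))⁻¹ * g) * ‖Φ g‖ₑ ∂μU ∂ν := lintegral_prod _ hk.aemeasurable
    _ = ∫⁻ u, ∫⁻ g, β (((u : G))⁻¹ * g) * ‖Φ g‖ₑ ∂ν ∂μU := lintegral_lintegral_swap hk.aemeasurable
    _ = ∫⁻ u, ∫⁻ g, β g * ‖Φ ((u : G) * g)‖ₑ ∂ν ∂μU := by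
        refine lintegral_congr fun u => ?_
        have h := lintegral_mul_left_eq_self (μ := ν) (fun y => β (((u : G))⁻¹ * y) * ‖Φ y‖ₑ) (u : G)
        simp only [inv_mul_cancel_left] at h
        exact h.symm
    _ = ∫⁻ g, ∫⁻ u, β g * ‖Φ ((u : G) * g)‖ₑ ∂μU ∂ν := (lintegral_lintegral_swap hk'.aemeasurable).symm
    _ = ∫⁻ g, β g * ∫⁻ u, ‖Φ ((u : G) * g)‖ₑ ∂μU ∂ν :=
        lintegral_congr fun g => lintegral_const_mul _ (hΦ.comp (measurable_subtype_coe.mul_const g)).enorm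
    _ < ∞ := hint

/-- **(E1) THE FIBRE WEIGHT.**  For measurable finite `β ≥ 0`, measurable `Φ : G → ℂ` with `∫⁻_G β(g) ∫⁻_U ‖Φ(u g)‖ dμ_U dν(g) < ∞`, and `B_β(g) := ∫⁻_U β(u⁻¹ g) dμ_U` finite:
`∫_G wt β(g) • (∫_U Φ(u g) dμ_U(u)) dν(g) = ∫_G wt B_β(g) • Φ(g) dν(g)` — Fubini, the change of variables `g ↦ u⁻¹ g` (left-invariance of `ν`), Fubini (no finiteness of `B_β` needed: where `B_β = ∞` both `toReal` conventions give `0`).  This is the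
regrouping `∫_{B(F)∖G} ∫_{N(𝔸)} = ∫_{T(F)∖G}` of the Maass–Selberg computation, in weight currency. [cite: MoeglinWaldspurger1995, II.1.8] [cite: Garrett2018, §1.10] -/
theorem integral_wt_smul_integral_translate {β : G → ℝ≥0∞} (hβ : Measurable β) (hβfin : ∀ g, β g ≠ ∞) {Φ : G → ℂ} (hΦ : Measurable Φ)
    (hint : ∫⁻ g, β g * ∫⁻ u, ‖Φ ((u : G) * g)‖ₑ ∂μU ∂ν < ∞) :
    ∫ g, (β g).toReal • (∫ u, Φ ((u : G) * g) ∂μU) ∂ν = ∫ g, (∫⁻ u, β (((u : G))⁻¹ * g) ∂μU).toReal • Φ g ∂ν := by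
  have hK := integrable_wt_smul_translate ν U μU hβ hβfin hΦ hint
  have hK' := integrable_wt_shear_smul ν U μU hβ hβfin hΦ hint
  calc ∫ g, (β g).toReal • (∫ u, Φ ((u : G) * g) ∂μU) ∂ν
      = ∫ g, ∫ u, (β g).toReal • Φ ((u : G) * g) ∂μU ∂ν := by simp_rw [integral_smul]
    _ = ∫ u, ∫ g, (β g).toReal • Φ ((u : G) * g) ∂ν ∂μU := integral_integral_swap hK
    _ = ∫ u, ∫ g, (β (((u : G))⁻¹ * g)).toReal • Φ g ∂ν ∂μU := by
        refine integral_congr_ae (ae_of_all _ fun u => ?_)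
        beta_reduce
        have h := integral_mul_left_eq_self (μ := ν) (fun y => (β (((u : G))⁻¹ * y)).toReal • Φ y) (u : G)
        simp only [inv_mul_cancel_left] at h
        exact h
    _ = ∫ g, ∫ u, (β (((u : G))⁻¹ * g)).toReal • Φ g ∂μU ∂ν := by
        have hK'' : Integrable (Function.uncurry fun (u : U) (g : G) => (β (((u : G))⁻¹ * g)).toReal • Φ g) (μU.prod ν) := hK'.swap
        exact integral_integral_swap hK''
    _ = ∫ g, (∫ u, (β (((u : G))⁻¹ * g)).toReal ∂μU) • Φ g ∂ν := by simp_rw [integral_smul_const]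
    _ = ∫ g, (∫⁻ u, β (((u : G))⁻¹ * g) ∂μU).toReal • Φ g ∂ν := by
        refine integral_congr_ae (ae_of_all _ fun g => ?_)
        beta_reduce
        have hm : Measurable fun u : U => β (((u : G))⁻¹ * g) := hβ.comp (measurable_subtype_coe.inv.mul_const g)
        rw [integral_toReal (f := fun u : U => β (((u : G))⁻¹ * g)) hm.aemeasurable (ae_of_all _ fun u => lt_top_iff_ne_top.2 (hβfin _))]

end Fibre

/-! ## §2 (E3) Twisting a `Γ_T`-weight by an element normalising `Γ_T` -/

section Twist

variable {G : Type*} [Group G]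

/-- **`coveringSum Γ_T (B ∘ (w ·)) g = coveringSum Γ_T B (w g)`** when `w Γ_T w⁻¹ = Γ_T`: reindex the orbit sum by `t ↦ w t w⁻¹`. [folklore] -/
theorem coveringSum_comp_mul_left (ΓT : Subgroup G) (B : G → ℝ≥0∞) {w : G} (hw : ∀ t ∈ ΓT, w * t * w⁻¹ ∈ ΓT) (hw' : ∀ t ∈ ΓT, w⁻¹ * t * w ∈ ΓT) (g : G) :
    coveringSum ΓT (fun g => B (w * g)) g = coveringSum ΓT B (w * g) := by
  let e : ΓT ≃ ΓT :=
    { toFun := fun t => ⟨w⁻¹ * t * w, hw' t t.2⟩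
      invFun := fun t => ⟨w * t * w⁻¹, hw t t.2⟩
      left_inv := fun t => Subtype.ext (by change w * (w⁻¹ * (t : G) * w) * w⁻¹ = t; group)
      right_inv := fun t => Subtype.ext (by change w⁻¹ * (w * (t : G) * w⁻¹) * w = t; group) }
  rw [coveringSum_apply, coveringSum_apply]
  conv_lhs => rw [← e.tsum_eq]
  refine tsum_congr fun t => ?_
  change B (w * ((w⁻¹ * (t : G) * w) * g)) = B ((t : G) * (w * g))
  congr 1; group

/-- Hence a weight of constant covering sum `V` stays one after the twist. [folklore] -/
theorem coveringSum_comp_mul_left_eq_const (ΓT : Subgroup G) {B : G → ℝ≥0∞} {V : ℝ≥0∞} (hV : ∀ g, coveringSum ΓT B g = V) {w : G}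
    (hw : ∀ t ∈ ΓT, w * t * w⁻¹ ∈ ΓT) (hw' : ∀ t ∈ ΓT, w⁻¹ * t * w ∈ ΓT) (g : G) :
    coveringSum ΓT (fun g => B (w * g)) g = V := by
  rw [coveringSum_comp_mul_left ΓT B hw hw' g, hV]

end Twist

/-! ## §3 (E4) Weight independence with a twist: `∫ wt B • Φ dν = ∫ wt B • Φ(w⁻¹ ·) dν` -/

section Independence

variable {G : Type*} [Group G] [MeasurableSpace G] [MeasurableMul G] (ν : Measure G) [ν.IsMulLeftInvariant]

/-- **(E4) WEIGHT INDEPENDENCE WITH A TWIST.**  `Γ_T ≤ G` countable, `B ≥ 0` measurable with `coveringSum Γ_T B ≡ V ∈ (0, ∞)`, `w` normalising `Γ_T`, `Φ : G → ℂ` measurable, left-`Γ_T`-invariant,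
with `∫⁻ ‖Φ‖ B dν < ∞`.  Then `∫ wt B • Φ dν = ∫ wt B • Φ(w⁻¹ ·) dν`: the weights `V⁻¹B` and `V⁻¹B(w ·)` both have covering sum `1` (§2), so ★ `integral_wt_smul_eq_of_coveringSum_eq_one` and
the substitution `g ↦ w g`. [cite: MoeglinWaldspurger1995, II.1.8] [cite: Garrett2018, §1.10] -/
theorem integral_wt_smul_eq_integral_wt_smul_comp_inv_mul (ΓT : Subgroup G) [Countable ΓT] {B : G → ℝ≥0∞} (hBm : Measurable B)
    {V : ℝ≥0∞} (hV0 : V ≠ 0) (hVtop : V ≠ ∞) (hV : ∀ g, coveringSum ΓT B g = V)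
    {w : G} (hw : ∀ t ∈ ΓT, w * t * w⁻¹ ∈ ΓT) (hw' : ∀ t ∈ ΓT, w⁻¹ * t * w ∈ ΓT)
    {Φ : G → ℂ} (hΦ : Measurable Φ) (hΦT : ∀ t ∈ ΓT, ∀ g : G, Φ (t * g) = Φ g) (hint : ∫⁻ g, ‖Φ g‖ₑ * B g ∂ν < ∞) :
    ∫ g, (B g).toReal • Φ g ∂ν = ∫ g, (B g).toReal • Φ (w⁻¹ * g) ∂ν := by
  haveI := measurableConstSMul_subgroup ΓT
  haveI := smulInvariantMeasure_subgroup ΓT ν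
  -- the normalised weights
  have hVinv0 : V⁻¹ ≠ 0 := ENNReal.inv_ne_zero.2 hVtop
  have hVinvtop : V⁻¹ ≠ ∞ := ENNReal.inv_ne_top.2 hV0
  have h₁ : ∀ g, coveringSum ΓT (fun g => V⁻¹ * B g) g = 1 := fun g => by
    rw [coveringSum_const_mul, hV, ENNReal.inv_mul_cancel hV0 hVtop]
  have h₂ : ∀ g, coveringSum ΓT (fun g => V⁻¹ * B (w * g)) g = 1 := fun g => by
    rw [coveringSum_const_mul, coveringSum_comp_mul_left_eq_const ΓT hV hw hw', ENNReal.inv_mul_cancel hV0 hVtop]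
  have hFinv : ∀ (γ : ΓT) (x : G), Φ (γ • x) = Φ x := fun γ x => hΦT γ γ.2 x
  have hint' : ∫⁻ g, ‖Φ g‖ₑ * (V⁻¹ * B g) ∂ν < ∞ := by
    have h : ∫⁻ g, ‖Φ g‖ₑ * (V⁻¹ * B g) ∂ν = V⁻¹ * ∫⁻ g, ‖Φ g‖ₑ * B g ∂ν := by
      have h' := lintegral_const_mul (μ := ν) V⁻¹ (hΦ.enorm.mul hBm)
      simp only [Pi.mul_apply] at h'
      rw [← h']
      exact lintegral_congr fun g => by ring
    rw [h]; exact ENNReal.mul_lt_top hVinvtop.lt_top hint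
  have key := integral_wt_smul_eq_of_coveringSum_eq_one ν hΦ.stronglyMeasurable hFinv (β₁ := fun g => V⁻¹ * B g) (β₂ := fun g => V⁻¹ * B (w * g))
    (measurable_const.mul hBm) (measurable_const.mul (hBm.comp (measurable_const_mul w))) h₁ h₂ hint'
  -- strip the factor `V⁻¹`
  simp only [wt, ENNReal.toReal_mul, ENNReal.toReal_inv, mul_smul, integral_smul] at key
  have hVr : V.toReal⁻¹ ≠ 0 := inv_ne_zero (ENNReal.toReal_ne_zero.2 ⟨hV0, hVtop⟩)
  have key' := smul_right_injective ℂ hVr key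
  -- `∫ (B (w g)).toReal • Φ g = ∫ (B g).toReal • Φ (w⁻¹ g)` by `g ↦ w g`
  rw [key']
  have h := integral_mul_left_eq_self (μ := ν) (fun y => (B y).toReal • Φ (w⁻¹ * y)) w
  simp only [inv_mul_cancel_left] at h
  exact h

end Independence

/-! ## §4 (E1c) The `L¹` norm against the fibre weight; measurability of the fibre weight -/

section FibreNorm

variable {G : Type*} [Group G] [MeasurableSpace G] [MeasurableMul₂ G] [MeasurableInv G] (ν : Measure G) [SFinite ν] [ν.IsMulLeftInvariant]
  (U : Subgroup G) (μU : Measure U) [SFinite μU]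

/-- The fibre weight `B_β(g) = ∫⁻_U β(u⁻¹ g) dμ_U` is measurable. [folklore] -/
theorem measurable_fibreWeight {β : G → ℝ≥0∞} (hβ : Measurable β) : Measurable fun g : G => ∫⁻ u, β (((u : G))⁻¹ * g) ∂μU :=
  (hβ.comp (((measurable_subtype_coe.comp measurable_snd).inv).mul measurable_fst)).lintegral_prod_right'

/-- **`∫⁻ ‖Φ‖ B_β dν = ∫⁻_G β(g) ∫⁻_U ‖Φ(u g)‖ dμ_U dν`** (Tonelli and `g ↦ u g`): the `L¹` hypothesis of (E4) IS the absolute-convergence hypothesis of (E1). [folklore] -/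
theorem lintegral_enorm_mul_fibreWeight_eq {β : G → ℝ≥0∞} (hβ : Measurable β) {Φ : G → ℂ} (hΦ : Measurable Φ) :
    ∫⁻ g, ‖Φ g‖ₑ * ∫⁻ u, β (((u : G))⁻¹ * g) ∂μU ∂ν = ∫⁻ g, β g * ∫⁻ u, ‖Φ ((u : G) * g)‖ₑ ∂μU ∂ν := by
  have hsh : Measurable fun p : G × U => ((p.2 : G))⁻¹ * p.1 := ((measurable_subtype_coe.comp measurable_snd).inv).mul measurable_fst
  have hk : Measurable fun p : G × U => β (((p.2 : G))⁻¹ * p.1) * ‖Φ p.1‖ₑ := (hβ.comp hsh).mul (hΦ.comp measurable_fst).enorm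
  have hk' : Measurable fun p : G × U => β p.1 * ‖Φ ((p.2 : G) * p.1)‖ₑ :=
    (hβ.comp measurable_fst).mul (hΦ.comp ((measurable_subtype_coe.comp measurable_snd).mul measurable_fst)).enorm
  calc ∫⁻ g, ‖Φ g‖ₑ * ∫⁻ u, β (((u : G))⁻¹ * g) ∂μU ∂ν
      = ∫⁻ g, ∫⁻ u, β (((u : G))⁻¹ * g) * ‖Φ g‖ₑ ∂μU ∂ν := by
        refine lintegral_congr fun g => ?_
        have hm : Measurable fun u : U => β (((u : G))⁻¹ * g) := hβ.comp (measurable_subtype_coe.inv.mul_const g)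
        rw [mul_comm]
        exact (lintegral_mul_const _ hm).symm
    _ = ∫⁻ u, ∫⁻ g, β (((u : G))⁻¹ * g) * ‖Φ g‖ₑ ∂ν ∂μU := lintegral_lintegral_swap hk.aemeasurable
    _ = ∫⁻ u, ∫⁻ g, β g * ‖Φ ((u : G) * g)‖ₑ ∂ν ∂μU := by
        refine lintegral_congr fun u => ?_
        have h := lintegral_mul_left_eq_self (μ := ν) (fun y => β (((u : G))⁻¹ * y) * ‖Φ y‖ₑ) (u : G)
        simp only [inv_mul_cancel_left] at h
        exact h.symm
    _ = ∫⁻ g, ∫⁻ u, β g * ‖Φ ((u : G) * g)‖ₑ ∂μU ∂ν := (lintegral_lintegral_swap hk'.aemeasurable).symm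
    _ = ∫⁻ g, β g * ∫⁻ u, ‖Φ ((u : G) * g)‖ₑ ∂μU ∂ν :=
        lintegral_congr fun g => lintegral_const_mul _ (hΦ.comp (measurable_subtype_coe.mul_const g)).enorm

end FibreNorm

/-! ## §5 (E2) The covering sum of the fibre weight: `Σ_{t ∈ Γ_T} B_β(t g) = μ_U(𝓕)` for a `Γ_B = Γ_T ⋉ Γ_N`-covering weight `β` -/

section CoveringSumFibre

variable {G : Type*} [Group G] [MeasurableSpace G] [MeasurableMul₂ G] (U : Subgroup G) [MeasurableMul₂ U] [MeasurableInv U]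
  (μU : Measure U) [SFinite μU] [μU.IsInvInvariant]

omit [SFinite μU] in
/-- **(E2) THE COVERING SUM OF THE FIBRE WEIGHT.**  Let `Γ_B, Γ_T ≤ G` and `Γ_N ≤ U` be countable with `Γ_B = Γ_T · Γ_N` bijectively (`e : Γ_T × Γ_N ≃ Γ_B`, `e(t, n) = t n`), `𝓕 ⊆ U` a
fundamental domain for the left action of `Γ_N` on `(U, μ_U)`, `μ_U` inversion-invariant and invariant under conjugation by `Γ_T` (`hconj`), and `β` a `Γ_B`-covering weight on `G`.  Then
for every `g`: `Σ_{t ∈ Γ_T} ∫⁻_U β(u⁻¹ t g) dμ_U = μ_U(𝓕)` — i.e. `B_β` is a `Γ_T`-weight of constant covering sum `vol(Γ_N∖U)`.  (Inversion, conjugation, unfolding `∫_U = Σ_{Γ_N} ∫_𝓕`,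
Tonelli, the bijection, `Σ_{Γ_B} β = 1`.) [cite: MoeglinWaldspurger1995, II.1.8] [cite: Garrett2018, §1.10] -/
theorem coveringSum_fibreWeight_eq (ΓB ΓT : Subgroup G) (ΓN : Subgroup U) [Countable ΓT] [Countable ΓN]
    [MeasurableConstSMul ΓN U] [SMulInvariantMeasure ΓN U μU]
    (e : ΓT × ΓN ≃ ΓB) (he : ∀ (t : ΓT) (n : ΓN), ((e (t, n) : ΓB) : G) = (t : G) * ((n : U) : G))
    {𝓕 : Set U} (h𝓕 : IsFundamentalDomain ΓN 𝓕 μU)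
    (htU : ∀ t ∈ ΓT, ∀ u : U, t⁻¹ * (u : G) * t ∈ U)
    (hconj : ∀ (t : G) (ht : t ∈ ΓT) (f : U → ℝ≥0∞), Measurable f → ∫⁻ u, f ⟨t⁻¹ * (u : G) * t, htU t ht u⟩ ∂μU = ∫⁻ u, f u ∂μU)
    {β : G → ℝ≥0∞} (hβ : IsCoveringWeight ΓB β) (g : G) :
    coveringSum ΓT (fun g => ∫⁻ u, β (((u : G))⁻¹ * g) ∂μU) g = μU 𝓕 := by
  have hβm := hβ.measurable
  rw [coveringSum_apply]
  -- `t`-th term: inversion and conjugation by `t`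
  have hterm : ∀ t : ΓT, ∫⁻ u, β (((u : G))⁻¹ * (t • g)) ∂μU = ∫⁻ u, β ((t : G) * (u : G) * g) ∂μU := fun t => by
    have h1 : ∫⁻ u, β (((u : G))⁻¹ * (t • g)) ∂μU = ∫⁻ u : U, β ((u : G) * ((t : G) * g)) ∂μU := by
      have h := lintegral_inv_eq_self (μ := μU) (fun u : U => β ((u : G) * ((t : G) * g)))
      simp only [Subgroup.coe_inv] at h
      exact h
    rw [h1, ← hconj (t : G) t.2 (fun u : U => β ((t : G) * (u : G) * g)) (hβm.comp ((measurable_subtype_coe.const_mul _).mul_const g))]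
    refine lintegral_congr fun u => ?_
    change β ((u : G) * ((t : G) * g)) = β ((t : G) * ((t : G)⁻¹ * (u : G) * (t : G)) * g)
    congr 1; group
  simp_rw [hterm]
  -- unfold `∫_U = Σ_{γ ∈ Γ_N} ∫_𝓕 (γ • ·)`
  have hunf : ∀ t : ΓT, ∫⁻ u, β ((t : G) * (u : G) * g) ∂μU = ∑' γ : ΓN, ∫⁻ v in 𝓕, β ((t : G) * (((γ : U) * v : U) : G) * g) ∂μU := fun t =>
    h𝓕.lintegral_eq_tsum'' fun u : U => β ((t : G) * (u : G) * g)
  simp_rw [hunf]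
  have hm : ∀ p : ΓT × ΓN, Measurable fun v : U => β ((p.1 : G) * ((((p.2 : U) * v : U)) : G) * g) := fun p =>
    hβm.comp ((measurable_const.mul (measurable_subtype_coe.comp (measurable_const_mul (p.2 : U)))).mul_const g)
  have hswap : ∑' p : ΓT × ΓN, ∫⁻ v in 𝓕, β ((p.1 : G) * ((((p.2 : U) * v : U)) : G) * g) ∂μU =
      ∫⁻ v in 𝓕, ∑' p : ΓT × ΓN, β ((p.1 : G) * ((((p.2 : U) * v : U)) : G) * g) ∂μU := (lintegral_tsum fun p => (hm p).aemeasurable).symm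
  rw [← ENNReal.tsum_prod, hswap]
  -- the double sum is the `Γ_B`-covering sum at `v g`, which is `1`
  have hsum : ∀ v : U, ∑' p : ΓT × ΓN, β ((p.1 : G) * ((((p.2 : U) * v : U)) : G) * g) = 1 := fun v => by
    have h := hβ.coveringSum_eq ((v : G) * g)
    rw [coveringSum_apply, ← e.tsum_eq] at h
    rw [← h]
    refine tsum_congr fun p => ?_
    obtain ⟨t, n⟩ := p
    change β ((t : G) * (((n : U) : G) * (v : G)) * g) = β (((e (t, n) : ΓB) : G) * ((v : G) * g))
    rw [he t n]
    congr 1; group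
  simp_rw [hsum]
  rw [setLIntegral_one]

end CoveringSumFibre

/-! ## §6 (E5) The adjointness, generic form -/

section Adjoint

variable {G : Type*} [Group G] [MeasurableSpace G] [MeasurableMul₂ G] [MeasurableInv G] (ν : Measure G) [SFinite ν] [ν.IsMulLeftInvariant]
  (U : Subgroup G) (μU : Measure U) [SFinite μU]

/-- **(E5) ADJOINTNESS OF THE INTERTWINING INTEGRAL, generic form.**  `⟨M_w h, f'⟩_β = ⟨h, M_{w⁻¹} f'⟩_β` where `⟨Ψ₁, Ψ₂⟩_β = ∫_G wt β • Ψ₁ · conj Ψ₂ dν` and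
`M_w h(g) = ∫_U h(w u g) dμ_U`, for measurable `h, f'` that are left-`U`-invariant and left-`Γ_T`-invariant, `w` normalising `Γ_T`, `β ≥ 0` finite measurable whose fibre weight
`B_β` is a `Γ_T`-weight of constant covering sum `V ∈ (0, ∞)` ((E2) computes `V = vol(Γ_N∖U)` for a `Γ_T ⋉ Γ_N`-covering weight), under the two absolute-convergence hypotheses.
(E1) twice, (E4) once. [cite: MoeglinWaldspurger1995, II.1.8] [cite: Garrett2018, §1.10–§1.11] -/
theorem integral_wt_smul_intertwining_mul_conj_eq (ΓT : Subgroup G) [Countable ΓT] {β : G → ℝ≥0∞} (hβ : Measurable β) (hβfin : ∀ g, β g ≠ ∞)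
    {V : ℝ≥0∞} (hV0 : V ≠ 0) (hVtop : V ≠ ∞) (hV : ∀ g, coveringSum ΓT (fun g => ∫⁻ u, β (((u : G))⁻¹ * g) ∂μU) g = V)
    {w : G} (hw : ∀ t ∈ ΓT, w * t * w⁻¹ ∈ ΓT) (hw' : ∀ t ∈ ΓT, w⁻¹ * t * w ∈ ΓT)
    {h f' : G → ℂ} (hhm : Measurable h) (hf'm : Measurable f')
    (hhU : ∀ (u : U) (g : G), h ((u : G) * g) = h g) (hf'U : ∀ (u : U) (g : G), f' ((u : G) * g) = f' g)
    (hhT : ∀ t ∈ ΓT, ∀ g : G, h (t * g) = h g) (hf'T : ∀ t ∈ ΓT, ∀ g : G, f' (t * g) = f' g)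
    (habs : ∫⁻ g, β g * ∫⁻ u, ‖h (w * ((u : G) * g)) * (starRingEnd ℂ) (f' g)‖ₑ ∂μU ∂ν < ∞)
    (habs' : ∫⁻ g, β g * ∫⁻ u, ‖h g * (starRingEnd ℂ) (f' (w⁻¹ * ((u : G) * g)))‖ₑ ∂μU ∂ν < ∞) :
    ∫ g, (β g).toReal • ((∫ u, h (w * ((u : G) * g)) ∂μU) * (starRingEnd ℂ) (f' g)) ∂ν =
      ∫ g, (β g).toReal • (h g * (starRingEnd ℂ) (∫ u, f' (w⁻¹ * ((u : G) * g)) ∂μU)) ∂ν := by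
  -- the two fibre integrands
  set ΦL : G → ℂ := fun y => h (w * y) * (starRingEnd ℂ) (f' y) with hΦL
  set ΦR : G → ℂ := fun y => h y * (starRingEnd ℂ) (f' (w⁻¹ * y)) with hΦR
  have hΦLm : Measurable ΦL := (hhm.comp (measurable_const_mul w)).mul (Complex.continuous_conj.measurable.comp hf'm)
  have hΦRm : Measurable ΦR := hhm.mul (Complex.continuous_conj.measurable.comp (hf'm.comp (measurable_const_mul w⁻¹)))
  -- LHS integrand: `(∫ h(w u g)) · conj f'(g) = ∫ ΦL(u g)`
  have hL : ∀ g : G, (∫ u, h (w * ((u : G) * g)) ∂μU) * (starRingEnd ℂ) (f' g) = ∫ u, ΦL ((u : G) * g) ∂μU := fun g => by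
    rw [← integral_mul_const]
    refine integral_congr_ae (ae_of_all _ fun u => ?_)
    simp only [hΦL, hf'U u g]
  have hR : ∀ g : G, h g * (starRingEnd ℂ) (∫ u, f' (w⁻¹ * ((u : G) * g)) ∂μU) = ∫ u, ΦR ((u : G) * g) ∂μU := fun g => by
    rw [← integral_conj, ← integral_const_mul]
    refine integral_congr_ae (ae_of_all _ fun u => ?_)
    simp only [hΦR, hhU u g]
  have habsL : ∫⁻ g, β g * ∫⁻ u, ‖ΦL ((u : G) * g)‖ₑ ∂μU ∂ν < ∞ := by
    refine lt_of_le_of_lt (le_of_eq (lintegral_congr fun g => ?_)) habs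
    congr 1; refine lintegral_congr fun u => ?_; simp only [hΦL, hf'U u g]
  have habsR : ∫⁻ g, β g * ∫⁻ u, ‖ΦR ((u : G) * g)‖ₑ ∂μU ∂ν < ∞ := by
    refine lt_of_le_of_lt (le_of_eq (lintegral_congr fun g => ?_)) habs'
    congr 1; refine lintegral_congr fun u => ?_; simp only [hΦR, hhU u g]
  simp_rw [hL, hR]
  rw [integral_wt_smul_integral_translate ν U μU hβ hβfin hΦLm habsL, integral_wt_smul_integral_translate ν U μU hβ hβfin hΦRm habsR]
  -- ΦL is `Γ_T`-invariant; ΦR = ΦL ∘ (w⁻¹ ·)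
  have hΦLT : ∀ t ∈ ΓT, ∀ g : G, ΦL (t * g) = ΦL g := fun t ht g => by
    simp only [hΦL, hf'T t ht g]
    rw [show w * (t * g) = (w * t * w⁻¹) * (w * g) by group, hhT _ (hw t ht)]
  have hRL : ∀ g : G, ΦR g = ΦL (w⁻¹ * g) := fun g => by simp only [hΦL, hΦR, mul_inv_cancel_left]
  have hint : ∫⁻ g, ‖ΦL g‖ₑ * ∫⁻ u, β (((u : G))⁻¹ * g) ∂μU ∂ν < ∞ := by
    rw [lintegral_enorm_mul_fibreWeight_eq ν U μU hβ hΦLm]; exact habsL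
  simp_rw [hRL]
  exact integral_wt_smul_eq_integral_wt_smul_comp_inv_mul ν ΓT (measurable_fibreWeight U μU hβ) hV0 hVtop hV hw hw' hΦLm hΦLT hint

end Adjoint

end Summit.HodgeConjecture.HodgeConjecture.Cruxes.H413.K2E1IntertwiningAdjointEngine

end
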